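import Summits.QuantumFields.YangMills.Theses.DualityDefect

/-!
# Birth skeleton (BC3) for crux `DefectUnimodal` (stmt-QuantumFields-11692) — `Lines/birth.lean`

Registrar: `planner-skel-stmt-QuantumFields-11692-0` (skeleton-register one-shot; route
`route-QuantumFields-DualityDefect`, re-audit bin REPAIRABLE), 2026-08-17.  Line card: `Lines/birth.md`.

Crux (route file `Theses/DualityDefect.lean`, decl
`Summit.QuantumFields.YangMills.Theses.DualityDefect.DefectUnimodal`, the route's target X₁, auto-crux
since 2026-08-16 "underived-target"): for every compact simple `G` and faithful unitary `r` there are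
`β₀`, `t₀` and a window length `ℓ(β) → ∞` such that for all `β ≥ β₀` and every infinite-volume limit
state `μ` at `β` there is `t⋆ ≥ ℓ(β)` with the Z-free channel ratio `R(n) = B(n)/A(n)`
(`A(n) = Cov(S₀, S_{ne₀}) `, `B(n) = −Cov(P₀, P_{ne₀})`, bare clover densities `S`, `P`) STRICTLY RISING
on `[t₀, t⋆)`, NOT rising at `t⋆`, and STRICTLY FALLING after `t⋆` (all in product form).

## The cut = the route's own three signs (its `Assembly` item, stmt-QuantumFields-11703)

The crux is a unimodality statement about one real sequence per state; it is the conjunction-in-kind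
of the three SIGN statements the route already files as ranked cruxes, and nothing else derives it
(that is why the gate back-filled it as a crux).  The skeleton registers exactly that factorisation,
with the stubs being the route's sibling items BY NAME (so proving a stub closes a route item and
conversely; no new statement text is introduced):

* `stub_infraredFall : InfraredFall` (stmt-QuantumFields-11693, rank 2, the hardest — INFRARED SIGN:
  for every `β > 0` and every limit state, eventually in `n`: `A(n) > 0`, `B(n) > 0`, `R(n+1) < R(n)`;
  "the 0⁻⁺ clover channel is strictly heavier than the 0⁺⁺ one in every state at every coupling").
* `stub_ultravioletRise : UltravioletRise` (stmt-QuantumFields-11694, rank 3 — ULTRAVIOLET SIGN: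
  `∃ β₀ t₀ ℓ`, `ℓ → ∞`, with `R(n) < R(n+1)` for `t₀ ≤ n < ℓ(β)` in every limit state at `β ≥ β₀`;
  asymptotic freedom orders the channels in the perturbative window).
* `stub_singlePeak : SinglePeak` (stmt-QuantumFields-11695, rank 4 — SINGLE CROSSING: `∃ β₀ t₀`, for
  `β ≥ β₀`, every limit state and every `n ≥ t₀`: `R(n+1) ≤ R(n) → R(n+2) < R(n+1)`).
* `DefectUnimodal_of : InfraredFall → UltravioletRise → SinglePeak → DefectUnimodal` — the composition,
  a REAL proof (no `sorry`): the abstract peak lemma `unimodal_of_signs` on `ℕ` (t⋆ := `Nat.find` of the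
  least `n ≥ t₀` with no strict rise — non-empty by the eventual fall; `ℓ β ≤ t⋆` because the rise holds
  below `ℓ β`; rise on `[t₀, t⋆)` by `Nat.find_min`; `≤` at `t⋆` by `not_lt`; strict fall for every
  `n > t⋆` by `Nat.le_induction` on the single-crossing step), instantiated with
  `β₀ := max (max β₀ᵁ β₀ˢ) 1` (so `β > 0` for the infrared sign), `t₀ := max t₀ᵁ t₀ˢ`, `ℓ := ℓᵁ`; the
  five `let`-binders `S P e A B` of the route decls are introduced as local definitions and the three
  hypotheses are used through them (definitional unfolding, no restatement).  This is literally a proof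
  of the route's `Assembly` item (stmt-QuantumFields-11703, `InfraredFall → UltravioletRise → SinglePeak →
  DefectUnimodal`; several sorry-free candidate proofs of the same shape are attached there as evidence
  by grounders/refuters of 2026-08-15 — this file re-derives it against the materialised route module);
  a prover may land it verbatim as `Theorems/DualityDefectAssembly.lean --workitem stmt-QuantumFields-11703`.

No stub is the crux or the summit in disguise: `InfraredFall` holds at EVERY `β > 0` but only
eventually in `n` and says nothing about a rise or a window; `UltravioletRise` speaks only below `ℓ(β)`;
`SinglePeak` is a conditional step (`non-rise at n ⇒ strict fall at n+1`) with no existence clause; none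
mentions OS data, schemes or `YangMills`.  BC3 probes (registrar folder `bc/`, importing the route file):
`stub → DefectUnimodal` and `stub → YangMills` by `first | exact? | simpa [Stub] | (unfold Stub; simpa) | aesop`
must FAIL for all three stubs (raw outputs in `Lines/birth.md`).

## Disproof used

None exists: `Cruxes/DefectUnimodal/` had no workfiles before this one (no `Disproof.lean`, no
`Theorems/DefectUnimodal/Negative/`, no registered stubs, no crux ideas — `ledger crux ls/ideas`,
2026-08-17); the summit's negatives index (5 refuted statements: RobustYangMillsRG, MirrorModularBoosts
DiagonalMirrorRP, AdaptiveCoarseSystem, MultibosonLatticeGap, AdmissibleRootsExist) contains nothing on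
clover two-point functions, and no stub is an instance of any of them.

`lean check`: rc 0; sorries = 3 = stubs (`stub_infraredFall`, `stub_ultravioletRise`, `stub_singlePeak`),
zero elsewhere (`unimodal_of_signs`, `DefectUnimodal_of` closed under propext/Classical.choice/Quot.sound).
Namespace `Summit.QuantumFields.YangMills.Cruxes.DefectUnimodal.Birth`.
-/

set_option autoImplicit false

namespace Summit.QuantumFields.YangMills.Cruxes.DefectUnimodal.Birth

open Summit.QuantumFields.YangMills.Theses.DualityDefect

/-- **The abstract peak lemma (pure order reasoning on `ℕ`, sorry-free).**  Two real sequences `A`,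
`B`; "rise at `n`" is `B n * A (n+1) < B (n+1) * A n` (i.e. `R(n) < R(n+1)` in product form) and
"fall at `n`" is `B (n+1) * A n < B n * A (n+1)`.  If the ratio eventually falls strictly (`hfall`),
rises strictly on `[t₀, L)` (`hrise`), and from `t₀` on a non-rise at `n` forces a strict fall at `n+1`
(`hsingle`), then there is ONE peak `t⋆ ≥ L`: strict rise on `[t₀, t⋆)`, non-rise at `t⋆`, strict fall
for every `n > t⋆`.  (`t⋆ := Nat.find` of the least `n ≥ t₀` without a strict rise.) -/
theorem unimodal_of_signs (A B : ℕ → ℝ) (t₀ L n₀ : ℕ)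
    (hfall : ∀ n, n₀ ≤ n → B (n + 1) * A n < B n * A (n + 1))
    (hrise : ∀ n, t₀ ≤ n → n < L → B n * A (n + 1) < B (n + 1) * A n)
    (hsingle : ∀ n, t₀ ≤ n → B (n + 1) * A n ≤ B n * A (n + 1) →
      B (n + 2) * A (n + 1) < B (n + 1) * A (n + 2)) :
    ∃ tstar : ℕ, L ≤ tstar ∧
      (∀ n, t₀ ≤ n → n < tstar → B n * A (n + 1) < B (n + 1) * A n) ∧
      B (tstar + 1) * A tstar ≤ B tstar * A (tstar + 1) ∧
      (∀ n, tstar < n → B (n + 1) * A n < B n * A (n + 1)) := by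
  classical
  have hex : ∃ n, t₀ ≤ n ∧ ¬ (B n * A (n + 1) < B (n + 1) * A n) :=
    ⟨max n₀ t₀, le_max_right _ _, fun h => lt_asymm h (hfall _ (le_max_left _ _))⟩
  have hspec := Nat.find_spec hex
  have ht₀ : t₀ ≤ Nat.find hex := hspec.1
  have hpeak : B (Nat.find hex + 1) * A (Nat.find hex) ≤ B (Nat.find hex) * A (Nat.find hex + 1) :=
    not_lt.mp hspec.2
  -- the weak fall propagates from the peak onwards (each strict fall weakened to `≤`)
  have hweak : ∀ m, Nat.find hex ≤ m → B (m + 1) * A m ≤ B m * A (m + 1) := by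
    intro m hm
    induction m, hm using Nat.le_induction with
    | base => exact hpeak
    | succ m hm ih => exact (hsingle m (le_trans ht₀ hm) ih).le
  refine ⟨Nat.find hex, ?_, ?_, hpeak, ?_⟩
  · -- `L ≤ t⋆`: below `L` the ratio still rises strictly, but it does not rise at `t⋆`
    exact not_lt.mp fun hlt => hspec.2 (hrise _ ht₀ hlt)
  · -- strict rise on `[t₀, t⋆)` by minimality of `t⋆`
    intro n hn hlt
    by_contra h
    exact Nat.find_min hex hlt ⟨hn, h⟩
  · -- strict fall for every `n > t⋆`
    intro n hn
    obtain ⟨m, rfl⟩ : ∃ m, n = m + 1 := ⟨n - 1, by omega⟩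
    have hm : Nat.find hex ≤ m := by omega
    exact hsingle m (le_trans ht₀ hm) (hweak m hm)

/-- **Stub 1 — INFRARED SIGN** (the route's rank-2 crux `InfraredFall`, stmt-QuantumFields-11693, BY NAME;
OPEN, the hardest piece): for every compact simple `G`, faithful unitary `r`, every `β > 0` and every
infinite-volume limit state `μ`, eventually in `n`: `A(n) > 0`, `B(n) > 0` and
`B(n+1) A(n) < B(n) A(n+1)` — the 0⁻⁺ clover channel is strictly heavier than the 0⁺⁺ one. -/
theorem stub_infraredFall : InfraredFall := by
  sorry

/-- **Stub 2 — ULTRAVIOLET SIGN** (the route's rank-3 crux `UltravioletRise`, stmt-QuantumFields-11694, BY NAME;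
OPEN): there are `β₀`, `t₀` and `ℓ : ℝ → ℕ` with `ℓ → ∞` such that for `β ≥ β₀`, every limit state and all
`t₀ ≤ n < ℓ β`: `A(n) > 0`, `B(n) > 0` and `B(n) A(n+1) < B(n+1) A(n)` (asymptotic freedom orders the
channels throughout the perturbative window). -/
theorem stub_ultravioletRise : UltravioletRise := by
  sorry

/-- **Stub 3 — SINGLE CROSSING** (the route's rank-4 crux `SinglePeak`, stmt-QuantumFields-11695, BY NAME;
OPEN): there are `β₀`, `t₀` such that for `β ≥ β₀`, every limit state and every `n ≥ t₀`:
`B(n+1) A(n) ≤ B(n) A(n+1) → B(n+2) A(n+1) < B(n+1) A(n+2)` (once the ratio stops rising it falls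
strictly for ever). -/
theorem stub_singlePeak : SinglePeak := by
  sorry

/-- **Composition (registered skeleton theorem; REAL proof, no `sorry`)** — the three stub STATEMENTS as
hypotheses give the crux BY NAME: `β₀ := max (max β₀ᵁ β₀ˢ) 1`, `t₀ := max t₀ᵁ t₀ˢ`, `ℓ := ℓᵁ`, and per
state the abstract peak lemma `unimodal_of_signs` with `L := ℓ β`.  The `let`-bound `S P e A B` of the
route decls are introduced as local definitions; the hypotheses are used through them definitionally.
This is verbatim a proof of the route's `Assembly` item (stmt-QuantumFields-11703). -/
theorem DefectUnimodal_of : InfraredFall → UltravioletRise → SinglePeak → DefectUnimodal := by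
  intro hI hU hS G i1 i2 i3 i4 i5 i6 hG r S P e A B
  obtain ⟨β₀U, t₀U, ℓ, hℓ, hU'⟩ := hU G hG r
  obtain ⟨β₀S, t₀S, hS'⟩ := hS G hG r
  refine ⟨max (max β₀U β₀S) 1, max t₀U t₀S, ℓ, hℓ, ?_⟩
  intro β hβ μ hμ
  have hβU : β₀U ≤ β := le_trans (le_trans (le_max_left _ _) (le_max_left _ _)) hβ
  have hβS : β₀S ≤ β := le_trans (le_trans (le_max_right _ _) (le_max_left _ _)) hβ
  have hβpos : (0 : ℝ) < β := lt_of_lt_of_le one_pos (le_trans (le_max_right _ _) hβ)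
  obtain ⟨n₀, hn₀⟩ := hI G hG r β hβpos μ hμ
  have hUβ := hU' β hβU μ hμ
  have hSβ := hS' β hβS μ hμ
  exact unimodal_of_signs (A μ) (B μ) (max t₀U t₀S) (ℓ β) n₀
    (fun n hn => (hn₀ n hn).2.2)
    (fun n hn hnl => (hUβ n (le_trans (le_max_left _ _) hn) hnl).2.2)
    (fun n hn hle => hSβ n (le_trans (le_max_right _ _) hn) hle)

/-- The stubs BY NAME compose to the crux (this `example` is where the three `sorry`s would enter a
proof of the crux; `DefectUnimodal_of` itself is closed). -/
example : DefectUnimodal := DefectUnimodal_of stub_infraredFall stub_ultravioletRise stub_singlePeak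

/-- Signature match: the composition concludes literally the route's crux decl (fully qualified). -/
example : InfraredFall → UltravioletRise → SinglePeak →
    Summit.QuantumFields.YangMills.Theses.DualityDefect.DefectUnimodal := DefectUnimodal_of

/-- … and it is literally the route's `Assembly` item. -/
example : Summit.QuantumFields.YangMills.Theses.DualityDefect.Assembly := DefectUnimodal_of

end Summit.QuantumFields.YangMills.Cruxes.DefectUnimodal.Birth
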